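import Mathlib

/-!
# Wall bubbling for `DoorA26` — the LETTERS ⇄ GRAM dictionary at `(2,K)` (kernel, def-free)

LINE.  Crux `Theses.LacunarySymmetroid.DoorA26` (stmt-ValiantsHypothesis-19979; OPEN, typed, never asserted), line `Cruxes/DoorA26/Lines/wall_bubbling.lean`.
The optional piece the line lead offered to free hands (l.11838, «LETTERS ⇄ GRAM DICTIONARY (2,K)»; W1 takes it as #9): the algebraic half of every
witness/readout that moves between six symmetric `2 × 2` LETTERS and the rank-3 GRAM shape `G = v vᵀ − u uᵀ − w wᵀ` of `(Sym₂ℝ, det) ≅ ℝ^{1,2}`: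
* (i) `det_pencil_letters_of_shape` / `coeff_det_pencil_letters_of_shape` — with `S_a = [[v_a + u_a, w_a],[w_a, v_a − u_a]]` (any number `K` of letters,
  any exponents `d`): `det (∑_a X^{d_a} • S_a) = ∑_{a,b} C(v_a v_b − u_a u_b − w_a w_b) X^{d_a+d_b}` (ordered pairs: class multiplicities `m_aa = 1`,
  `m_ab = 2`), and the coefficient form;
* (ii) `polar_letters_of_shape`, `letters_isSymm` — conversely those letters realise `G` as their polar table `polar(S_a,S_b) = v_a v_b − u_a u_b − w_a w_b`
  (so every shape is `Realisable` with `ε = 1`; the inverse direction is `realisable_shape` of `…WallBubblingMixedParity`).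
HONEST FRAMING.  Cell `pub-symmetroid`, seat val-sym-door-p2 g11 (W1), `--supports stmt-ValiantsHypothesis-19979 --as helper`.  Polynomial algebra; no
new definitions; zero COUNTS stay hub-side (line lead); (M), (W), (R), `DoorA26` OPEN; nothing on `MatrixDescartes` (stmt-18050) or `VP ≠ VNP`. [folklore]
-/

-- `Summit.ValiantsHypothesis.ValiantsHypothesis.…` repeats a component by the D-0017 layout
-- (single-conjunct summit), which the `dupNamespace` linter flags; the name is mandated.
set_option linter.dupNamespace false

namespace Summit.ValiantsHypothesis.ValiantsHypothesis.Theorems.LacunarySymmetroidMatrixDescartes.WallBubbling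

open Polynomial Matrix Finset
open scoped BigOperators



/-- **GRAM ⇒ LETTERS (ii).**  The letters `S_a = [[v_a + u_a, w_a],[w_a, v_a − u_a]]` realise `G = v vᵀ − u uᵀ − w wᵀ` as their polar table:
`polar(S_a, S_b) = ((S_a+S_b).det − S_a.det − S_b.det)/2 = v_a v_b − u_a u_b − w_a w_b` (inverse direction of `realisable_shape` of `…MixedParity`). [folklore] -/
theorem polar_letters_of_shape {K : ℕ} (v u w : Fin K → ℝ) (a b : Fin K) :
    ((!![v a + u a, w a; w a, v a - u a] + !![v b + u b, w b; w b, v b - u b]).det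
      - (!![v a + u a, w a; w a, v a - u a]).det - (!![v b + u b, w b; w b, v b - u b]).det) / 2
      = v a * v b - u a * u b - w a * w b := by
  simp [Matrix.det_fin_two]
  ring

/-- The letters are symmetric. [folklore] -/
theorem letters_isSymm {K : ℕ} (v u w : Fin K → ℝ) (a : Fin K) : (!![v a + u a, w a; w a, v a - u a]).IsSymm := by
  ext i j; fin_cases i <;> fin_cases j <;> rfl

/-- An antisymmetric double sum of polynomials vanishes. [folklore] -/
theorem sum_sum_eq_zero_of_antisymm {K : ℕ} (F : Fin K → Fin K → ℝ[X]) (h : ∀ a b, F a b = -F b a) :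
    ∑ a, ∑ b, F a b = 0 := by
  have hT : ∑ a, ∑ b, F a b = -∑ a, ∑ b, F a b := by
    conv_lhs => rw [Finset.sum_comm]
    rw [← Finset.sum_neg_distrib]
    refine Finset.sum_congr rfl fun a _ => ?_
    rw [← Finset.sum_neg_distrib]
    exact Finset.sum_congr rfl fun b _ => h b a
  have h2 : ∑ a, ∑ b, F a b + ∑ a, ∑ b, F a b = 0 := by
    nth_rewrite 2 [hT]; exact add_neg_cancel _
  exact add_self_eq_zero.mp h2

/-- **LETTERS ⇒ DETERMINANT (i), polynomial form.**  For the letters `S_a = [[v_a + u_a, w_a],[w_a, v_a − u_a]]` and any exponents `d`,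
`det (∑_a X^{d_a} • S_a) = ∑_a ∑_b C(v_a v_b − u_a u_b − w_a w_b) · X^{d_a + d_b}` — the sum over ORDERED pairs, so on a support with distinct
pair-sum classes the coefficient of `x^{d_a+d_b}` is `m_ab · (v_a v_b − u_a u_b − w_a w_b)` with `m_aa = 1`, `m_ab = 2` (`a ≠ b`)
(`coeff_det_pencil_letters_of_shape`).  Proof: expand `det` of the `2 × 2` pencil and kill the antisymmetric part `u_a v_b − v_a u_b`. [folklore] -/
theorem det_pencil_letters_of_shape {K : ℕ} (d : Fin K → ℕ) (v u w : Fin K → ℝ) :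
    (∑ a, (X : ℝ[X]) ^ d a • (!![v a + u a, w a; w a, v a - u a]).map C).det
      = ∑ a, ∑ b, C (v a * v b - u a * u b - w a * w b) * X ^ (d a + d b) := by
  rw [Matrix.det_fin_two]
  have e00 : (∑ a, (X : ℝ[X]) ^ d a • (!![v a + u a, w a; w a, v a - u a]).map C) 0 0 = ∑ a, X ^ d a * C (v a + u a) := by
    simp [Matrix.sum_apply]
  have e11 : (∑ a, (X : ℝ[X]) ^ d a • (!![v a + u a, w a; w a, v a - u a]).map C) 1 1 = ∑ a, X ^ d a * C (v a - u a) := by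
    simp [Matrix.sum_apply]
  have e01 : (∑ a, (X : ℝ[X]) ^ d a • (!![v a + u a, w a; w a, v a - u a]).map C) 0 1 = ∑ a, X ^ d a * C (w a) := by
    simp [Matrix.sum_apply]
  have e10 : (∑ a, (X : ℝ[X]) ^ d a • (!![v a + u a, w a; w a, v a - u a]).map C) 1 0 = ∑ a, X ^ d a * C (w a) := by
    simp [Matrix.sum_apply]
  rw [e00, e11, e01, e10, Finset.sum_mul_sum, Finset.sum_mul_sum, ← Finset.sum_sub_distrib]
  simp_rw [← Finset.sum_sub_distrib]
  -- termwise: X^da C(α) * (X^db C(β)) − X^da C(w a) * (X^db C(w b)) = C(v v − u u − w w) X^(da+db) + C(u_a v_b − v_a u_b) X^(da+db)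
  have hterm : ∀ a b, (X : ℝ[X]) ^ d a * C (v a + u a) * (X ^ d b * C (v b - u b)) - X ^ d a * C (w a) * (X ^ d b * C (w b))
      = C (v a * v b - u a * u b - w a * w b) * X ^ (d a + d b) + C (u a * v b - v a * u b) * X ^ (d a + d b) := by
    intro a b
    have : (X : ℝ[X]) ^ d a * C (v a + u a) * (X ^ d b * C (v b - u b)) - X ^ d a * C (w a) * (X ^ d b * C (w b))
        = C ((v a + u a) * (v b - u b) - w a * w b) * X ^ (d a + d b) := by
      simp only [C_sub, C_add, C_mul, pow_add]; ring
    rw [this, ← add_mul, ← C_add]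
    congr 2
    ring
  simp_rw [hterm, Finset.sum_add_distrib]
  rw [sum_sum_eq_zero_of_antisymm (fun a b => C (u a * v b - v a * u b) * (X : ℝ[X]) ^ (d a + d b)) (fun a b => by
    rw [add_comm (d b) (d a), ← neg_mul, ← C_neg]; congr 2; ring), add_zero]


/-- **Coefficient form of (i).**  The coefficient of `X^n` in `det (∑_a X^{d_a} • S_a)` is `∑_{(a,b) : d_a + d_b = n} (v_a v_b − u_a u_b − w_a w_b)`
(ordered pairs). [folklore] -/
theorem coeff_det_pencil_letters_of_shape {K : ℕ} (d : Fin K → ℕ) (v u w : Fin K → ℝ) (n : ℕ) :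
    ((∑ a, (X : ℝ[X]) ^ d a • (!![v a + u a, w a; w a, v a - u a]).map C).det).coeff n
      = ∑ a, ∑ b, if d a + d b = n then v a * v b - u a * u b - w a * w b else 0 := by
  rw [det_pencil_letters_of_shape, Polynomial.finsetSum_coeff]
  refine Finset.sum_congr rfl fun a _ => ?_
  rw [Polynomial.finsetSum_coeff]
  refine Finset.sum_congr rfl fun b _ => ?_
  rw [Polynomial.coeff_C_mul_X_pow]
  by_cases h : d a + d b = n
  · simp [h]
  · rw [if_neg (Ne.symm h), if_neg h]

end Summit.ValiantsHypothesis.ValiantsHypothesis.Theorems.LacunarySymmetroidMatrixDescartes.WallBubbling
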